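import Mathlib
import HarnessLib
import Literature.Combinatorics.Additive.IsoperimetricMethod

/-!
# Hamidoune–Rødseth's inverse theorem mod `p`, I: runs, components and the observations of §2

Topic `Literature/Combinatorics/Additive`.  Companion of `Vosper.lean` (`apFinset`, `IsAP`, Vosper's
theorem) and `IsoperimetricMethod.lean` (which PROVES the two heavy inputs of Hamidoune–Rødseth's paper:
their Theorem 5 — one above the Cauchy–Davenport bound forces a double progression,
`Isoperimetric.exists_card_vadd_sdiff_le_of_card_add_le` — and their Lemma 1,
`Isoperimetric.subset_apFinset_of_isAP_of_card_add_le`).  This file and its sequels type the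
COMBINATORIAL ENDGAME of

* Y. O. Hamidoune, Ø. J. Rødseth, *An inverse theorem mod p*, Acta Arith. 92 (2000) 251–262
  (read at the page from the publisher's open copy, `lit read paper:url-91a40b2366eb`, pp. 251–261),

whose main result (Theorem 3, p. 252) is: "Suppose that `|A|, |B| ≥ 3`, and that
`7 ≤ |A + B| = |A| + |B| ≤ p − 4`.  Then `A` and `B` are almost-progressions with the same difference."

## Vocabulary (p. 251 and p. 253 of the paper, in the tree's words)

For `X ⊆ ℤ/pℤ` and a step `d ≠ 0` we write, as in `IsoperimetricMethod.lean`, `#((d +ᵥ X) \ X)` for the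
number of maximal `d`-progressions ("`d`-components", p. 253) of `X ≠ ℤ/pℤ` — observation (V) of the paper,
`|{0, d} + X| = |X| + k`, is `Isoperimetric.card_add_pair_zero_eq`.  "`X` is a `d`-progression" is
`IsAP X d` / `X = apFinset a d |X|`; "`X` is an almost `d`-progression" (a `d`-progression with at most one
term removed) is `∃ a, X ⊆ apFinset a d (|X| + 1)`; "`X` is a double `d`-progression" is
`#((d +ᵥ X) \ X) ≤ 2`.  A `d`-COMPONENT of `X` is handled through explicit data: a run
`apFinset a d n ⊆ X`, `n ≥ 1`, with `a − d ∉ X` and `a + n • d ∉ X`.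

## What is here (all PROVED, 0 `sorry`, no named facts)

* run-count bookkeeping: subadditivity under union, invariance under translation;
* arithmetic of `apFinset` in `ℤ/pℤ`: index uniqueness, the two neighbours of a run are outside it, a
  sub-run of a run sits at an offset (`exists_offset_of_apFinset_subset`), the sum of two runs is a run
  (`apFinset_add_apFinset_eq`);
* components: existence of the component through a point (`exists_component`), maximality
  (`subset_component_of_inter_nonempty`), two components are equal or disjoint, the run-end of a
  component is a point of `(d + X) ∖ X`, and the decomposition of a double progression into its two
  components (`exists_two_components`);
* the paper's observation (IV) (`subset_apFinset_of_card_add_triple_le`: `|{0,d,2d} + A| ≤ |A| + 3`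
  forces an almost `d`-progression) and its engine `subset_apFinset_of_runs_le_two_of_runs_union_le_one`;
* **Lemma 3** of the paper (`subset_apFinset_of_isAP_add`: if `A + B` is a `d`-progression and
  `|A + B| ≤ |A| + |B| ≤ p − 3` then `A` is an almost `d`-progression);
* the hole lemmas used in the sequel: an almost progression which is not a progression misses an
  INTERIOR point of its hull (`exists_interior_hole`), and then adding a run of length `≥ 2` fills the
  hole (`insert_add_eq_add_of_neighbours`).

Lemmas 4–8 and Theorem 3 are in the sequel files `HamidouneRodsethLemmas.lean`,
`HamidouneRodsethInverseTheorem.lean`.  Nothing in this file is specific to the matrix-multiplication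
census that motivated it (pub-omega, seat stpp-1 gen 31); it is census-silent.
-/

namespace Literature.Combinatorics.Additive

open Finset
open scoped Pointwise

namespace HamidouneRodseth

variable {p : ℕ} [hp : Fact p.Prime]

/-! ## Cardinality bookkeeping in `ℤ/pℤ` -/

/-- A proper subset of `ℤ/pℤ` has fewer than `p` elements. [cite: Nathanson1996, §2.5 (arithmetic progressions in ℤ/pℤ)] -/
theorem card_lt_of_ne_univ {s : Finset (ZMod p)} (h : s ≠ univ) : #s < p := by
  have := (card_lt_iff_ne_univ _).2 h
  rwa [ZMod.card] at this

/-- A subset of `ℤ/pℤ` with fewer than `p` elements is proper. [cite: Nathanson1996, §2.5 (arithmetic progressions in ℤ/pℤ)] -/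
theorem ne_univ_of_card_lt {s : Finset (ZMod p)} (h : #s < p) : s ≠ univ := by
  apply (card_lt_iff_ne_univ _).1
  rwa [ZMod.card]

/-- In `ℤ/pℤ`, `i • d = j • d` with `d ≠ 0` and `i, j < p` forces `i = j`. [cite: Nathanson1996, §2.5 (arithmetic progressions in ℤ/pℤ)] -/
theorem nat_eq_of_nsmul_eq {d : ZMod p} (hd : d ≠ 0) {i j : ℕ} (hi : i < p) (hj : j < p)
    (h : i • d = j • d) : i = j := by
  rw [nsmul_eq_mul, nsmul_eq_mul] at h
  have h' : (i : ZMod p) = j := mul_right_cancel₀ hd h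
  have h'' := congrArg ZMod.val h'
  rwa [ZMod.val_natCast, ZMod.val_natCast, Nat.mod_eq_of_lt hi, Nat.mod_eq_of_lt hj] at h''

/-- `p • d = 0` in `ℤ/pℤ`. [cite: Nathanson1996, §2.5 (arithmetic progressions in ℤ/pℤ)] -/
theorem prime_nsmul_eq_zero (d : ZMod p) : p • d = 0 := by
  rw [nsmul_eq_mul, ZMod.natCast_self, zero_mul]

/-! ## Run counts: subadditivity and translation -/

/-- The run count is subadditive: `h_d(X ∪ Y) ≤ h_d(X) + h_d(Y)`. [cite: HamidouneRodseth2000, §2 (p. 253: residue classes as points on a circle, `d`-components)] -/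
theorem card_vadd_sdiff_union_le (d : ZMod p) (X Y : Finset (ZMod p)) :
    #((d +ᵥ (X ∪ Y)) \ (X ∪ Y)) ≤ #((d +ᵥ X) \ X) + #((d +ᵥ Y) \ Y) := by
  calc #((d +ᵥ (X ∪ Y)) \ (X ∪ Y)) ≤ #(((d +ᵥ X) \ X) ∪ ((d +ᵥ Y) \ Y)) := by
        apply card_le_card
        intro x hx
        rw [vadd_finset_union, mem_sdiff, mem_union, mem_union, not_or] at hx
        rw [mem_union, mem_sdiff, mem_sdiff]
        tauto
    _ ≤ #((d +ᵥ X) \ X) + #((d +ᵥ Y) \ Y) := card_union_le _ _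

/-- The run count of a union of three sets is at most the sum of the three run counts. [cite: HamidouneRodseth2000, §2 (p. 253: residue classes as points on a circle, `d`-components)] -/
theorem card_vadd_sdiff_union_three_le (d : ZMod p) (X Y Z : Finset (ZMod p)) :
    #((d +ᵥ (X ∪ Y ∪ Z)) \ (X ∪ Y ∪ Z)) ≤ #((d +ᵥ X) \ X) + #((d +ᵥ Y) \ Y) + #((d +ᵥ Z) \ Z) :=
  (card_vadd_sdiff_union_le d (X ∪ Y) Z).trans (by
    have := card_vadd_sdiff_union_le d X Y
    omega)

/-- The run count is invariant under translation. [cite: HamidouneRodseth2000, §2 (p. 253: residue classes as points on a circle, `d`-components)] -/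
theorem card_vadd_sdiff_vadd (c d : ZMod p) (X : Finset (ZMod p)) :
    #((d +ᵥ (c +ᵥ X)) \ (c +ᵥ X)) = #((d +ᵥ X) \ X) := by
  rw [vadd_vadd, add_comm, ← vadd_vadd, ← vadd_finset_sdiff, card_vadd_finset]

/-! ## Arithmetic of runs `apFinset a d n` in `ℤ/pℤ` -/

/-- Index uniqueness inside a run: for `i < p`, `a + i • d ∈ apFinset a d n ↔ i < n` (`d ≠ 0`, `n ≤ p`).
[cite: Nathanson1996, §2.5 (arithmetic progressions in ℤ/pℤ)] -/
theorem add_nsmul_mem_apFinset_iff {a d : ZMod p} (hd : d ≠ 0) {n : ℕ} (hn : n ≤ p) {i : ℕ} (hi : i < p) :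
    a + i • d ∈ apFinset a d n ↔ i < n := by
  constructor
  · intro h
    obtain ⟨j, hj, hji⟩ := mem_apFinset.1 h
    have := nat_eq_of_nsmul_eq hd (lt_of_lt_of_le hj hn) hi (add_left_cancel hji)
    omega
  · intro h
    exact mem_apFinset.2 ⟨i, h, rfl⟩

/-- The point just after a run of fewer than `p` terms is not in the run. [cite: Nathanson1996, §2.5 (arithmetic progressions in ℤ/pℤ)] -/
theorem add_nsmul_notMem_apFinset {a d : ZMod p} (hd : d ≠ 0) {n : ℕ} (hn : n < p) :
    a + n • d ∉ apFinset a d n := by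
  rw [add_nsmul_mem_apFinset_iff hd hn.le hn]
  exact lt_irrefl n

/-- The point just before a run of fewer than `p` terms is not in the run. [cite: Nathanson1996, §2.5 (arithmetic progressions in ℤ/pℤ)] -/
theorem sub_notMem_apFinset {a d : ZMod p} (hd : d ≠ 0) {n : ℕ} (hn : n < p) :
    a - d ∉ apFinset a d n := by
  have hp1 : p - 1 < p := Nat.sub_lt hp.out.pos one_pos
  have heq : a - d = a + (p - 1) • d := by
    have : (p - 1) • d + d = p • d := by rw [← succ_nsmul, Nat.sub_add_cancel hp.out.one_le]
    rw [prime_nsmul_eq_zero] at this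
    rw [sub_eq_iff_eq_add, add_assoc, this, add_zero]
  rw [heq, add_nsmul_mem_apFinset_iff hd hn.le hp1]
  omega

/-- A superset of `univ` is `univ`. [cite: Nathanson1996, §2.5 (arithmetic progressions in ℤ/pℤ)] -/
theorem eq_univ_of_subset {s t : Finset (ZMod p)} (h : s ⊆ t) (hs : s = univ) : t = univ :=
  univ_subset_iff.1 (hs ▸ h)

/-- A run of at least `p` terms is everything. [cite: Nathanson1996, §2.5 (arithmetic progressions in ℤ/pℤ)] -/
theorem apFinset_eq_univ_of_le {a d : ZMod p} (hd : d ≠ 0) {n : ℕ} (hn : p ≤ n) : apFinset a d n = univ :=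
  eq_univ_of_subset (Isoperimetric.apFinset_mono a d hn) (apFinset_eq_univ a hd)

/-- A run inside a proper subset has fewer than `p` terms. [cite: Nathanson1996, §2.5 (arithmetic progressions in ℤ/pℤ)] -/
theorem lt_of_apFinset_subset_ne_univ {a d : ZMod p} (hd : d ≠ 0) {n : ℕ} {X : Finset (ZMod p)}
    (hX : X ≠ univ) (h : apFinset a d n ⊆ X) : n < p := by
  by_contra hle
  push Not at hle
  exact hX (eq_univ_of_subset h (apFinset_eq_univ_of_le hd hle))

/-- Consecutive membership: if `x + j • d ∈ apFinset a d L` for all `j ≤ m`, where `x = a + i • d` with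
`i < L < p`... then the indices do not wrap: `i + m < L`. [cite: Nathanson1996, §2.5 (arithmetic progressions in ℤ/pℤ)] -/
theorem index_add_lt_of_forall_mem {a d : ZMod p} (hd : d ≠ 0) {L : ℕ} (hL : L < p) {i : ℕ} (hi : i < L)
    {m : ℕ} (h : ∀ j ≤ m, a + i • d + j • d ∈ apFinset a d L) : i + m < L := by
  induction m with
  | zero => simpa using hi
  | succ m ih =>
    have him : i + m < L := ih fun j hj => h j (by omega)
    have hmem := h (m + 1) le_rfl
    rw [add_assoc, ← add_nsmul] at hmem
    exact (add_nsmul_mem_apFinset_iff hd hL.le (by omega)).1 hmem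

/-- **A sub-run of a run sits at an offset.**  If `apFinset x d m ⊆ apFinset y d L` with `m ≥ 1`, `L < p`,
`d ≠ 0`, then `x = y + i • d` for some `i` with `i + m ≤ L`. [cite: Nathanson1996, §2.5 (arithmetic progressions in ℤ/pℤ)] -/
theorem exists_offset_of_apFinset_subset {x y d : ZMod p} (hd : d ≠ 0) {m L : ℕ} (hm : 1 ≤ m) (hL : L < p)
    (h : apFinset x d m ⊆ apFinset y d L) : ∃ i : ℕ, x = y + i • d ∧ i + m ≤ L := by
  have hx : x ∈ apFinset y d L := h (mem_apFinset.2 ⟨0, by omega, by simp⟩)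
  obtain ⟨i, hi, rfl⟩ := mem_apFinset.1 hx
  refine ⟨i, rfl, ?_⟩
  have := index_add_lt_of_forall_mem hd hL hi (m := m - 1) fun j hj =>
    h (mem_apFinset.2 ⟨j, by omega, rfl⟩)
  omega

/-- **The sum of two runs with the same step is a run**: in `ℤ/pℤ`, for `m, n ≥ 1` and
`apFinset a d m + apFinset b d n ≠ ℤ/pℤ` (`d ≠ 0`),
`apFinset a d m + apFinset b d n = apFinset (a + b) d (m + n − 1)` and it has `m + n − 1` elements.
[cite: Nathanson1996, §2.5 (proof of Thm 2.7, case (iii))] -/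
theorem apFinset_add_apFinset_eq {a b d : ZMod p} (hd : d ≠ 0) {m n : ℕ} (hm : 1 ≤ m) (hn : 1 ≤ n)
    (hne : apFinset a d m + apFinset b d n ≠ univ) :
    apFinset a d m + apFinset b d n = apFinset (a + b) d (m + n - 1) ∧
      #(apFinset a d m + apFinset b d n) = m + n - 1 := by
  have hsub := apFinset_add_apFinset_subset a b d m n
  have hmp : m < p := by
    by_contra hle; push Not at hle
    apply hne
    apply eq_univ_of_subset _ (apFinset_eq_univ (a + b) hd)
    intro z hz
    obtain ⟨i, hi, rfl⟩ := mem_apFinset.1 hz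
    exact mem_add.2 ⟨a + i • d, mem_apFinset.2 ⟨i, by omega, rfl⟩, b,
      mem_apFinset.2 ⟨0, by omega, by simp⟩, by abel⟩
  have hnp : n < p := by
    by_contra hle; push Not at hle
    apply hne
    apply eq_univ_of_subset _ (apFinset_eq_univ (a + b) hd)
    intro z hz
    obtain ⟨i, hi, rfl⟩ := mem_apFinset.1 hz
    exact mem_add.2 ⟨a, mem_apFinset.2 ⟨0, by omega, by simp⟩, b + i • d,
      mem_apFinset.2 ⟨i, by omega, rfl⟩, by abel⟩
  have hcm : #(apFinset a d m) = m := card_apFinset hd hmp.le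
  have hcn : #(apFinset b d n) = n := card_apFinset hd hnp.le
  have hcd := Vosper.cauchy_davenport_of_ne_univ (apFinset_nonempty a d (by omega))
    (apFinset_nonempty b d (by omega)) hne
  rw [hcm, hcn] at hcd
  have hle : #(apFinset (a + b) d (m + n - 1)) ≤ m + n - 1 := card_apFinset_le _ _ _
  have heq : apFinset a d m + apFinset b d n = apFinset (a + b) d (m + n - 1) :=
    eq_of_subset_of_card_le hsub (by omega)
  refine ⟨heq, ?_⟩
  have := card_le_card hsub
  omega

/-- A translate of a run is a run with the same step and length. [cite: Nathanson1996, §2.5 (arithmetic progressions in ℤ/pℤ)] -/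
theorem vadd_apFinset_eq (c a d : ZMod p) (n : ℕ) : c +ᵥ apFinset a d n = apFinset (c + a) d n :=
  vadd_apFinset c a d n

/-- The run-end of a run: `(d + apFinset a d n) ∖ apFinset a d n ⊆ {a + n • d}`. [cite: HamidouneRodseth2000, §2 (p. 253: residue classes as points on a circle, `d`-components)] -/
theorem vadd_sdiff_apFinset_subset (a d : ZMod p) (n : ℕ) :
    (d +ᵥ apFinset a d n) \ apFinset a d n ⊆ {a + n • d} := by
  intro z hz
  rw [mem_sdiff, mem_vadd_finset] at hz
  obtain ⟨⟨y, hy, rfl⟩, hz⟩ := hz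
  obtain ⟨i, hi, rfl⟩ := mem_apFinset.1 hy
  rw [mem_singleton]
  have hi1 : i + 1 = n := by
    by_contra hne
    apply hz
    exact mem_apFinset.2 ⟨i + 1, by omega, by rw [succ_nsmul, vadd_eq_add]; abel⟩
  rw [← hi1, succ_nsmul, vadd_eq_add]
  abel

/-- A run is a `d`-progression in the sense of `IsAP` (when it has fewer than `p` terms... so that its
length is its cardinality). [cite: Nathanson1996, §2.5 (arithmetic progressions in ℤ/pℤ)] -/
theorem isAP_apFinset {a d : ZMod p} (hd : d ≠ 0) {n : ℕ} (hn : n ≤ p) : IsAP (apFinset a d n) d :=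
  ⟨a, by rw [card_apFinset hd hn]⟩

/-- At most one run means a progression: `#((d + X) ∖ X) ≤ 1`, `X ≠ ℤ/pℤ` ⇒ `IsAP X d`.
[cite: HamidouneRodseth2000, §2 observation (I) (p. 253)] -/
theorem isAP_of_card_vadd_sdiff_le_one {X : Finset (ZMod p)} {d : ZMod p} (hd : d ≠ 0) (hXu : X ≠ univ)
    (h1 : #((d +ᵥ X) \ X) ≤ 1) : IsAP X d := by
  obtain ⟨s, hs, -⟩ := Isoperimetric.exists_eq_apFinset_of_card_vadd_sdiff_le_one hd hXu h1
  exact ⟨s, hs⟩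

/-! ## Components (maximal runs) -/

/-- **Maximality of a component.**  Let `C = apFinset a d n ⊆ X` with `a − d ∉ X`, `a + n • d ∉ X`
(a `d`-component of `X`, p. 253).  A run `apFinset b d m ⊆ X` that meets `C` is contained in `C`.
[cite: HamidouneRodseth2000, §2 (p. 253: "`Y` is a maximal `d`-progression contained in `A`")] -/
theorem subset_component_of_inter_nonempty {X : Finset (ZMod p)} {a b d : ZMod p} (hd : d ≠ 0) {n m : ℕ}
    (hCX : apFinset a d n ⊆ X) (hpre : a - d ∉ X) (hpost : a + n • d ∉ X)
    (hPX : apFinset b d m ⊆ X) (hmeet : (apFinset b d m ∩ apFinset a d n).Nonempty) :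
    apFinset b d m ⊆ apFinset a d n := by
  have hXu : X ≠ univ := fun h => hpre (h ▸ mem_univ _)
  have hnp : n < p := lt_of_apFinset_subset_ne_univ hd hXu hCX
  -- closure of `C` under steps inside `X`
  have fwd : ∀ y ∈ apFinset a d n, y + d ∈ X → y + d ∈ apFinset a d n := by
    intro y hy hyd
    obtain ⟨i, hi, rfl⟩ := mem_apFinset.1 hy
    have hi1 : i + 1 < n := by
      by_contra hge
      have : i + 1 = n := by omega
      apply hpost
      rw [← this, succ_nsmul, ← add_assoc]
      exact hyd
    exact mem_apFinset.2 ⟨i + 1, hi1, by rw [succ_nsmul, add_assoc]⟩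
  have bwd : ∀ y ∈ apFinset a d n, y - d ∈ X → y - d ∈ apFinset a d n := by
    intro y hy hyd
    obtain ⟨i, hi, rfl⟩ := mem_apFinset.1 hy
    rcases Nat.eq_zero_or_pos i with h0 | hpos
    · rw [h0, zero_nsmul, add_zero] at hyd
      exact absurd hyd hpre
    · refine mem_apFinset.2 ⟨i - 1, by omega, ?_⟩
      rw [eq_sub_iff_add_eq, add_assoc, ← succ_nsmul, Nat.sub_add_cancel hpos]
  obtain ⟨z, hz⟩ := hmeet
  rw [mem_inter] at hz
  obtain ⟨hzP, hzC⟩ := hz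
  obtain ⟨j, hj, rfl⟩ := mem_apFinset.1 hzP
  -- walk inside the run `P` in both directions from the common point
  have up : ∀ t : ℕ, j + t < m → b + (j + t) • d ∈ apFinset a d n := by
    intro t
    induction t with
    | zero => intro _; simpa using hzC
    | succ t ih =>
      intro ht
      have prev := ih (by omega)
      have hmem : b + (j + t) • d + d ∈ X := hPX (mem_apFinset.2 ⟨j + t + 1, by omega, by
        rw [succ_nsmul, add_assoc]⟩)
      have := fwd _ prev hmem
      rwa [show j + (t + 1) = j + t + 1 by omega, succ_nsmul, ← add_assoc]
  have down : ∀ t : ℕ, t ≤ j → b + (j - t) • d ∈ apFinset a d n := by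
    intro t
    induction t with
    | zero => intro _; simpa using hzC
    | succ t ih =>
      intro ht
      have prev := ih (by omega)
      have hmem : b + (j - t) • d - d ∈ X := by
        apply hPX
        refine mem_apFinset.2 ⟨j - t - 1, by omega, ?_⟩
        rw [eq_sub_iff_add_eq, add_assoc, ← succ_nsmul, show j - t - 1 + 1 = j - t by omega]
      have := bwd _ prev hmem
      rwa [show b + (j - t) • d - d = b + (j - (t + 1)) • d by
        rw [sub_eq_iff_eq_add, add_assoc, ← succ_nsmul, show j - (t + 1) + 1 = j - t by omega]] at this
  intro y hy
  obtain ⟨k, hk, rfl⟩ := mem_apFinset.1 hy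
  rcases Nat.lt_or_ge k j with hkj | hjk
  · have := down (j - k) (by omega)
    rwa [show j - (j - k) = k by omega] at this
  · have := up (k - j) (by omega)
    rwa [show j + (k - j) = k by omega] at this

/-- Two components of `X` that meet are equal. [cite: HamidouneRodseth2000, §2 (p. 253: "a set `A` has a
unique partition into `d`-components")] -/
theorem component_eq_of_inter_nonempty {X : Finset (ZMod p)} {a b d : ZMod p} (hd : d ≠ 0) {n m : ℕ}
    (hCX : apFinset a d n ⊆ X) (hpre : a - d ∉ X) (hpost : a + n • d ∉ X)
    (hDX : apFinset b d m ⊆ X) (hpre' : b - d ∉ X) (hpost' : b + m • d ∉ X)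
    (hmeet : (apFinset a d n ∩ apFinset b d m).Nonempty) : apFinset a d n = apFinset b d m :=
  Subset.antisymm (subset_component_of_inter_nonempty hd hDX hpre' hpost' hCX hmeet)
    (subset_component_of_inter_nonempty hd hCX hpre hpost hDX (by rwa [inter_comm]))

/-- The run-end of a component of `X` lies in `(d + X) ∖ X` (`n ≥ 1`). [cite: HamidouneRodseth2000, §2 (p. 253: residue classes as points on a circle, `d`-components)] -/
theorem component_end_mem {X : Finset (ZMod p)} {a d : ZMod p} {n : ℕ} (hn : 1 ≤ n)
    (hCX : apFinset a d n ⊆ X) (hpost : a + n • d ∉ X) : a + n • d ∈ (d +ᵥ X) \ X := by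
  rw [mem_sdiff, mem_vadd_finset]
  refine ⟨⟨a + (n - 1) • d, hCX (mem_apFinset.2 ⟨n - 1, by omega, rfl⟩), ?_⟩, hpost⟩
  rw [vadd_eq_add, show n = n - 1 + 1 by omega, succ_nsmul]
  abel

/-- Distinct (hence disjoint) components have distinct run-ends. [cite: HamidouneRodseth2000, §2 (p. 253: residue classes as points on a circle, `d`-components)] -/
theorem component_end_ne {X : Finset (ZMod p)} {a b d : ZMod p} (hd : d ≠ 0) {n m : ℕ} (hn : 1 ≤ n)
    (hm : 1 ≤ m) (hCX : apFinset a d n ⊆ X) (hpre : a - d ∉ X) (hpost : a + n • d ∉ X)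
    (hDX : apFinset b d m ⊆ X) (hpre' : b - d ∉ X) (hpost' : b + m • d ∉ X)
    (hne : apFinset a d n ≠ apFinset b d m) : a + n • d ≠ b + m • d := by
  intro heq
  apply hne
  apply component_eq_of_inter_nonempty hd hCX hpre hpost hDX hpre' hpost'
  refine ⟨a + (n - 1) • d, mem_inter.2 ⟨mem_apFinset.2 ⟨n - 1, by omega, rfl⟩,
    mem_apFinset.2 ⟨m - 1, by omega, ?_⟩⟩⟩
  have h1 : a + (n - 1) • d + d = b + (m - 1) • d + d := by
    rw [add_assoc, ← succ_nsmul, add_assoc, ← succ_nsmul, Nat.sub_add_cancel hn,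
      Nat.sub_add_cancel hm, heq]
  exact (add_right_cancel h1).symm

/-- **Existence of the component through a point.**  For `d ≠ 0`, `X ≠ ℤ/pℤ` and `x ∈ X` there is a
component `apFinset a d n ⊆ X` (`n ≥ 1`, `a − d ∉ X`, `a + n • d ∉ X`) containing `x`.
[cite: HamidouneRodseth2000, §2 (p. 253)] -/
theorem exists_component {X : Finset (ZMod p)} {d : ZMod p} (hd : d ≠ 0) (hXu : X ≠ univ) {x : ZMod p}
    (hx : x ∈ X) : ∃ a : ZMod p, ∃ n : ℕ, 1 ≤ n ∧ apFinset a d n ⊆ X ∧ a - d ∉ X ∧ a + n • d ∉ X ∧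
      x ∈ apFinset a d n := by
  obtain ⟨c, hc⟩ : ∃ c, c ∉ X := by
    by_contra h; push Not at h; exact hXu (eq_univ_of_forall h)
  have hF : x + ((c - x) * d⁻¹).val • d = c := by
    rw [nsmul_eq_mul, ZMod.natCast_zmod_val, inv_mul_cancel_right₀ hd, add_sub_cancel]
  have hB : x - ((x - c) * d⁻¹).val • d = c := by
    rw [nsmul_eq_mul, ZMod.natCast_zmod_val, inv_mul_cancel_right₀ hd, sub_sub_cancel]
  have hexitF : ∃ j : ℕ, x + j • d ∉ X := ⟨_, hF.symm ▸ hc⟩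
  have hexitB : ∃ j : ℕ, x - j • d ∉ X := ⟨_, hB.symm ▸ hc⟩
  set f := Nat.find hexitF with hf
  set g := Nat.find hexitB with hg
  have hf_spec : x + f • d ∉ X := Nat.find_spec hexitF
  have hg_spec : x - g • d ∉ X := Nat.find_spec hexitB
  have hf_min : ∀ j < f, x + j • d ∈ X := fun j hj => by
    have := Nat.find_min hexitF hj; push Not at this; exact this
  have hg_min : ∀ j < g, x - j • d ∈ X := fun j hj => by
    have := Nat.find_min hexitB hj; push Not at this; exact this
  have hf1 : 1 ≤ f := by
    rw [Nat.one_le_iff_ne_zero]; intro h0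
    apply hf_spec; rw [h0, zero_nsmul, add_zero]; exact hx
  have hg1 : 1 ≤ g := by
    rw [Nat.one_le_iff_ne_zero]; intro h0
    apply hg_spec; rw [h0, zero_nsmul, sub_zero]; exact hx
  refine ⟨x - (g - 1) • d, g - 1 + f, by omega, ?_, ?_, ?_, ?_⟩
  · intro y hy
    obtain ⟨i, hi, rfl⟩ := mem_apFinset.1 hy
    rcases Nat.lt_or_ge i (g - 1) with hlt | hle
    · have := hg_min (g - 1 - i) (by omega)
      convert this using 1
      obtain ⟨k, hk⟩ : ∃ k, g - 1 = i + k := ⟨g - 1 - i, by omega⟩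
      rw [show g - 1 - i = k by omega, hk, add_nsmul]
      abel
    · have := hf_min (i - (g - 1)) (by omega)
      convert this using 1
      obtain ⟨k, hk⟩ : ∃ k, i = (g - 1) + k := ⟨i - (g - 1), by omega⟩
      rw [show i - (g - 1) = k by omega, hk, add_nsmul]
      abel
  · convert hg_spec using 1
    rw [sub_sub, ← succ_nsmul, Nat.sub_add_cancel hg1]
  · have : x - (g - 1) • d + (g - 1 + f) • d = x + f • d := by rw [add_nsmul]; abel
    rw [this]; exact hf_spec
  · refine mem_apFinset.2 ⟨g - 1, by omega, ?_⟩
    rw [sub_add_cancel]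

/-- **Three pairwise distinct components force at least three runs.** [cite: HamidouneRodseth2000, §2 (p. 253: residue classes as points on a circle, `d`-components)] -/
theorem three_le_card_vadd_sdiff {X : Finset (ZMod p)} {a b c d : ZMod p} (hd : d ≠ 0) {n m l : ℕ}
    (hn : 1 ≤ n) (hm : 1 ≤ m) (hl : 1 ≤ l)
    (hCX : apFinset a d n ⊆ X) (hpre : a - d ∉ X) (hpost : a + n • d ∉ X)
    (hDX : apFinset b d m ⊆ X) (hpre' : b - d ∉ X) (hpost' : b + m • d ∉ X)
    (hEX : apFinset c d l ⊆ X) (hpre'' : c - d ∉ X) (hpost'' : c + l • d ∉ X)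
    (h12 : apFinset a d n ≠ apFinset b d m) (h13 : apFinset a d n ≠ apFinset c d l)
    (h23 : apFinset b d m ≠ apFinset c d l) : 3 ≤ #((d +ᵥ X) \ X) := by
  have e12 := component_end_ne hd hn hm hCX hpre hpost hDX hpre' hpost' h12
  have e13 := component_end_ne hd hn hl hCX hpre hpost hEX hpre'' hpost'' h13
  have e23 := component_end_ne hd hm hl hDX hpre' hpost' hEX hpre'' hpost'' h23
  have hsub : ({a + n • d, b + m • d, c + l • d} : Finset (ZMod p)) ⊆ (d +ᵥ X) \ X := by
    intro z hz
    simp only [mem_insert, mem_singleton] at hz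
    rcases hz with rfl | rfl | rfl
    · exact component_end_mem hn hCX hpost
    · exact component_end_mem hm hDX hpost'
    · exact component_end_mem hl hEX hpost''
  have := card_le_card hsub
  rw [card_insert_of_notMem (by rw [mem_insert, mem_singleton, not_or]; exact ⟨e12, e13⟩),
    card_pair e23] at this
  exact this

/-- **Two distinct components force at least two runs.** [cite: HamidouneRodseth2000, §2 (p. 253: residue classes as points on a circle, `d`-components)] -/
theorem two_le_card_vadd_sdiff {X : Finset (ZMod p)} {a b d : ZMod p} (hd : d ≠ 0) {n m : ℕ}
    (hn : 1 ≤ n) (hm : 1 ≤ m)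
    (hCX : apFinset a d n ⊆ X) (hpre : a - d ∉ X) (hpost : a + n • d ∉ X)
    (hDX : apFinset b d m ⊆ X) (hpre' : b - d ∉ X) (hpost' : b + m • d ∉ X)
    (h12 : apFinset a d n ≠ apFinset b d m) : 2 ≤ #((d +ᵥ X) \ X) := by
  have e12 := component_end_ne hd hn hm hCX hpre hpost hDX hpre' hpost' h12
  have hsub : ({a + n • d, b + m • d} : Finset (ZMod p)) ⊆ (d +ᵥ X) \ X := by
    intro z hz
    simp only [mem_insert, mem_singleton] at hz
    rcases hz with rfl | rfl
    · exact component_end_mem hn hCX hpost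
    · exact component_end_mem hm hDX hpost'
  have := card_le_card hsub
  rw [card_pair e12] at this
  exact this

/-- **A run inside `X` meeting another run inside `X` with `X` their union makes `X` a single run**:
if `X = P ∪ Q` for runs `P, Q` with `P ∩ Q ≠ ∅` and `X ≠ ℤ/pℤ`, then `#((d + X) ∖ X) ≤ 1`. [cite: HamidouneRodseth2000, §2 (p. 253: residue classes as points on a circle, `d`-components)] -/
theorem card_vadd_sdiff_le_one_of_union_of_inter_nonempty {X : Finset (ZMod p)} {a b d : ZMod p}
    (hd : d ≠ 0) {n m : ℕ} (hXu : X ≠ univ) (hX : X = apFinset a d n ∪ apFinset b d m)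
    (hmeet : (apFinset a d n ∩ apFinset b d m).Nonempty) : #((d +ᵥ X) \ X) ≤ 1 := by
  obtain ⟨z, hz⟩ := hmeet
  have hzX : z ∈ X := by rw [hX]; exact mem_union_left _ (mem_inter.1 hz).1
  obtain ⟨c, l, -, hCX, hpre, hpost, hzC⟩ := exists_component hd hXu hzX
  have hP : apFinset a d n ⊆ apFinset c d l :=
    subset_component_of_inter_nonempty hd hCX hpre hpost (by rw [hX]; exact subset_union_left)
      ⟨z, mem_inter.2 ⟨(mem_inter.1 hz).1, hzC⟩⟩
  have hQ : apFinset b d m ⊆ apFinset c d l :=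
    subset_component_of_inter_nonempty hd hCX hpre hpost (by rw [hX]; exact subset_union_right)
      ⟨z, mem_inter.2 ⟨(mem_inter.1 hz).2, hzC⟩⟩
  have hXC : X = apFinset c d l := Subset.antisymm (by rw [hX]; exact union_subset hP hQ) hCX
  rw [hXC]
  exact Isoperimetric.card_vadd_sdiff_apFinset_le_one c d l

/-- **The two components of a double progression.**  If `d ≠ 0` and `#((d + X) ∖ X) = 2` then
`X = apFinset a₁ d n₁ ∪ apFinset a₂ d n₂` with `n₁, n₂ ≥ 1`, `n₁ + n₂ = #X`, both pieces components
(`aᵢ − d ∉ X`, `aᵢ + nᵢ • d ∉ X`) and disjoint. [cite: HamidouneRodseth2000, §2 observation (II) (p. 253)] -/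
theorem exists_two_components {X : Finset (ZMod p)} {d : ZMod p} (hd : d ≠ 0) (h2 : #((d +ᵥ X) \ X) = 2) :
    ∃ a₁ a₂ : ZMod p, ∃ n₁ n₂ : ℕ, 1 ≤ n₁ ∧ 1 ≤ n₂ ∧ n₁ + n₂ = #X ∧
      X = apFinset a₁ d n₁ ∪ apFinset a₂ d n₂ ∧ Disjoint (apFinset a₁ d n₁) (apFinset a₂ d n₂) ∧
      apFinset a₁ d n₁ ⊆ X ∧ a₁ - d ∉ X ∧ a₁ + n₁ • d ∉ X ∧
      apFinset a₂ d n₂ ⊆ X ∧ a₂ - d ∉ X ∧ a₂ + n₂ • d ∉ X := by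
  have hXne : X.Nonempty := by
    rw [nonempty_iff_ne_empty]; rintro rfl
    rw [vadd_finset_empty, empty_sdiff, card_empty] at h2
    exact absurd h2 (by norm_num)
  have hXu : X ≠ univ := by
    rintro rfl
    rw [vadd_finset_univ, sdiff_self, Finset.bot_eq_empty, card_empty] at h2
    exact absurd h2 (by norm_num)
  obtain ⟨x, hx⟩ := hXne
  obtain ⟨a₁, n₁, hn₁, hC₁, hpre₁, hpost₁, -⟩ := exists_component hd hXu hx
  have hn₁p : n₁ < p := lt_of_apFinset_subset_ne_univ hd hXu hC₁
  -- `X` is not this single component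
  obtain ⟨y, hyX, hyC⟩ : ∃ y ∈ X, y ∉ apFinset a₁ d n₁ := by
    by_contra h; push Not at h
    have hXC : X = apFinset a₁ d n₁ := Subset.antisymm h hC₁
    have := Isoperimetric.card_vadd_sdiff_apFinset_le_one a₁ d n₁
    rw [← hXC, h2] at this
    exact absurd this (by norm_num)
  obtain ⟨a₂, n₂, hn₂, hC₂, hpre₂, hpost₂, hyC₂⟩ := exists_component hd hXu hyX
  have hn₂p : n₂ < p := lt_of_apFinset_subset_ne_univ hd hXu hC₂
  have hne : apFinset a₁ d n₁ ≠ apFinset a₂ d n₂ := by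
    intro h; rw [h] at hyC; exact hyC hyC₂
  have hdisj : Disjoint (apFinset a₁ d n₁) (apFinset a₂ d n₂) := by
    rw [disjoint_iff_inter_eq_empty]
    by_contra hne'
    exact hne (component_eq_of_inter_nonempty hd hC₁ hpre₁ hpost₁ hC₂ hpre₂ hpost₂
      (nonempty_iff_ne_empty.2 hne'))
  -- every point of `X` lies in one of the two
  have hcover : X ⊆ apFinset a₁ d n₁ ∪ apFinset a₂ d n₂ := by
    intro z hz
    by_contra hzn
    rw [mem_union, not_or] at hzn
    obtain ⟨a₃, n₃, hn₃, hC₃, hpre₃, hpost₃, hzC₃⟩ := exists_component hd hXu hz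
    have h13 : apFinset a₁ d n₁ ≠ apFinset a₃ d n₃ := by
      intro h; rw [h] at hzn; exact hzn.1 hzC₃
    have h23 : apFinset a₂ d n₂ ≠ apFinset a₃ d n₃ := by
      intro h; rw [h] at hzn; exact hzn.2 hzC₃
    have := three_le_card_vadd_sdiff hd hn₁ hn₂ hn₃ hC₁ hpre₁ hpost₁ hC₂ hpre₂ hpost₂ hC₃ hpre₃ hpost₃
      hne h13 h23
    omega
  have hXeq : X = apFinset a₁ d n₁ ∪ apFinset a₂ d n₂ := Subset.antisymm hcover (union_subset hC₁ hC₂)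
  refine ⟨a₁, a₂, n₁, n₂, hn₁, hn₂, ?_, hXeq, hdisj, hC₁, hpre₁, hpost₁, hC₂, hpre₂, hpost₂⟩
  have := card_union_of_disjoint hdisj
  rw [← hXeq, card_apFinset hd hn₁p.le, card_apFinset hd hn₂p.le] at this
  omega

/-! ## One-step sumsets `X + {0, d}` and the paper's observations (III)/(IV) -/

/-- `X + {0, d} = X ∪ (d + X)`. [cite: HamidouneRodseth2000, §2 (p. 253: residue classes as points on a circle, `d`-components)] -/
theorem add_pair_zero_eq_union (X : Finset (ZMod p)) (d : ZMod p) :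
    X + ({0, d} : Finset (ZMod p)) = X ∪ (d +ᵥ X) := by
  rw [add_comm, insert_eq, union_add, singleton_add, singleton_add]
  simp

/-- A run plus `{0, d}` is the run with one more term (`n ≥ 1`). [cite: Nathanson1996, §2.5 (arithmetic progressions in ℤ/pℤ)] -/
theorem apFinset_add_pair_zero {a d : ZMod p} {n : ℕ} (hn : 1 ≤ n) :
    apFinset a d n + ({0, d} : Finset (ZMod p)) = apFinset a d (n + 1) := by
  obtain ⟨k, rfl⟩ : ∃ k, n = k + 1 := ⟨n - 1, by omega⟩
  rw [add_pair_zero_eq_union, ← apFinset_succ_eq_union a d (by omega : 0 < k + 1)]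

/-- **The engine of observation (IV).**  If `X ≠ ∅` has at most two `d`-runs (`d ≠ 0`) and
`Y = X ∪ (d + X) ≠ ℤ/pℤ` has at most one, then `X` is an almost `d`-progression:
`X ⊆ {s, s + d, …, s + |X| d}`.  (The last point of the run `Y` is not in `X`, since its successor is
outside `Y ⊇ d + X`.) [cite: HamidouneRodseth2000, §2 observation (IV) (p. 253)] -/
theorem subset_apFinset_of_runs_le_two_of_runs_union_le_one {X : Finset (ZMod p)} {d : ZMod p} (hd : d ≠ 0)
    (hX : X.Nonempty) (h2 : #((d +ᵥ X) \ X) ≤ 2) (hYu : X ∪ (d +ᵥ X) ≠ univ)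
    (h1 : #((d +ᵥ (X ∪ (d +ᵥ X))) \ (X ∪ (d +ᵥ X))) ≤ 1) : ∃ s : ZMod p, X ⊆ apFinset s d (#X + 1) := by
  set Y := X ∪ (d +ᵥ X) with hY
  obtain ⟨s, hYeq, hYp⟩ := Isoperimetric.exists_eq_apFinset_of_card_vadd_sdiff_le_one hd hYu h1
  have hcardY : #Y = #X + #((d +ᵥ X) \ X) := by
    rw [hY, union_comm, ← card_sdiff_add_card (s := d +ᵥ X) (t := X)]; omega
  set m := #Y with hm
  have hm1 : 1 ≤ m := by rw [hm]; exact card_pos.2 (hX.mono subset_union_left)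
  -- the last point of `Y` is not in `X`
  have hlast : s + (m - 1) • d ∉ X := by
    intro hmem
    have hnext : s + (m - 1) • d + d ∈ Y :=
      mem_union_right _ (mem_vadd_finset.2 ⟨_, hmem, by rw [vadd_eq_add, add_comm]⟩)
    rw [hYeq, add_assoc, ← succ_nsmul, Nat.sub_add_cancel hm1] at hnext
    exact add_nsmul_notMem_apFinset hd hYp hnext
  refine ⟨s, fun x hx => ?_⟩
  have hxY : x ∈ Y := mem_union_left _ hx
  rw [hYeq] at hxY
  obtain ⟨i, hi, rfl⟩ := mem_apFinset.1 hxY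
  have hi' : i ≠ m - 1 := by rintro rfl; exact hlast hx
  exact mem_apFinset.2 ⟨i, by omega, rfl⟩

/-- **Observation (IV) of Hamidoune–Rødseth** (p. 253): "If `|A| ≤ p − 4`, then
`|{0, 1, 2} + A| ≤ |A| + 3` if and only if `A` is an almost 1-progression" — the direction used, for a
general step `d ≠ 0`: if `A ≠ ∅`, `A + {0,d} + {0,d} ≠ ℤ/pℤ` and `|A + {0,d} + {0,d}| ≤ |A| + 3`, then
`A ⊆ {s, s + d, …, s + |A| d}` for some `s`.  Proof: `|A + {0,d}| = |A| + h(A)` and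
`|A + {0,d} + {0,d}| = |A| + h(A) + h(A ∪ (d + A))` with `h(A ∪ (d + A)) ≥ 1`, so `h(A) ≤ 2`; if
`h(A) ≤ 1` then `A` is a progression, else `h(A ∪ (d + A)) = 1` and the engine applies.
[cite: HamidouneRodseth2000, §2 observation (IV) (p. 253)] -/
theorem subset_apFinset_of_card_add_pair_add_pair_le {A : Finset (ZMod p)} {d : ZMod p} (hd : d ≠ 0)
    (hA : A.Nonempty) (hu : A + {0, d} + {0, d} ≠ (univ : Finset (ZMod p)))
    (h3 : #(A + {0, d} + ({0, d} : Finset (ZMod p))) ≤ #A + 3) : ∃ s : ZMod p, A ⊆ apFinset s d (#A + 1) := by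
  have h1 := Isoperimetric.card_add_pair_zero_eq A d
  have h2 := Isoperimetric.card_add_pair_zero_eq (A + {0, d}) d
  have hY : A + ({0, d} : Finset (ZMod p)) = A ∪ (d +ᵥ A) := add_pair_zero_eq_union A d
  have hYu : A + ({0, d} : Finset (ZMod p)) ≠ univ := by
    intro hYu
    apply hu
    rw [hYu]
    exact eq_univ_of_subset (subset_add_left _ (by simp)) rfl
  have hYne : (A + ({0, d} : Finset (ZMod p))).Nonempty := hA.add (by simp)
  have hge1 := Isoperimetric.one_le_card_vadd_sdiff hYne hYu hd
  by_cases hA1 : #((d +ᵥ A) \ A) ≤ 1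
  · have hAu : A ≠ univ := fun h => hYu (eq_univ_of_subset (subset_add_left _ (by simp)) h)
    obtain ⟨s, hs, -⟩ := Isoperimetric.exists_eq_apFinset_of_card_vadd_sdiff_le_one hd hAu hA1
    exact ⟨s, hs.le.trans (Isoperimetric.apFinset_mono s d (by omega))⟩
  · have hYu' : A ∪ (d +ᵥ A) ≠ univ := by rw [← hY]; exact hYu
    have key : #((d +ᵥ (A ∪ (d +ᵥ A))) \ (A ∪ (d +ᵥ A))) ≤ 1 := by rw [← hY]; omega
    exact subset_apFinset_of_runs_le_two_of_runs_union_le_one hd hA (by omega) hYu' key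

/-- `{0, d, 2d}`-sumsets: `X + {0,d} + {0,d} = X + apFinset 0 d 3`. [cite: Nathanson1996, §2.5 (arithmetic progressions in ℤ/pℤ)] -/
theorem add_pair_add_pair_eq (X : Finset (ZMod p)) (d : ZMod p) :
    X + {0, d} + ({0, d} : Finset (ZMod p)) = X + apFinset 0 d 3 := by
  have h2 : apFinset (0 : ZMod p) d 2 = {0, d} := by
    ext x
    simp only [mem_apFinset, mem_insert, mem_singleton, zero_add]
    constructor
    · rintro ⟨i, hi, rfl⟩
      interval_cases i <;> simp
    · rintro (rfl | rfl)
      · exact ⟨0, by omega, by simp⟩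
      · exact ⟨1, by omega, by simp⟩
  have h3 : ({0, d} : Finset (ZMod p)) + {0, d} = apFinset 0 d 3 := by
    rw [← apFinset_add_pair_zero (by norm_num : 1 ≤ 2) (a := (0 : ZMod p)) (d := d), h2]
  rw [add_assoc, h3]

/-- **Lemma 3 of Hamidoune–Rødseth** (p. 253): "Suppose that `A + B` is a `d`-progression such that
`|A + B| ≤ |A| + |B| ≤ p − 3`.  Then `A` is an almost `d`-progression."  Proof as printed (p. 254):
`p − 1 ≥ |A| + |B| + 2 ≥ |A + B| + 2 ≥ |{0,d,2d} + A + B| ≥ |{0,d,2d} + A| + |B| − 1` (Cauchy–Davenport),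
so `|{0,d,2d} + A| ≤ |A| + 3`, and observation (IV) applies.
[cite: HamidouneRodseth2000, §2 Lemma 3 (pp. 253–254)] -/
theorem subset_apFinset_of_isAP_add {A B : Finset (ZMod p)} {d : ZMod p} (hd : d ≠ 0) (hA : A.Nonempty)
    (hB : B.Nonempty) (hAP : IsAP (A + B) d) (hAB : #(A + B) ≤ #A + #B) (hp3 : #A + #B + 3 ≤ p) :
    ∃ s : ZMod p, A ⊆ apFinset s d (#A + 1) := by
  have hBpos := hB.card_pos
  set T : Finset (ZMod p) := apFinset 0 d 3 with hT
  obtain ⟨c, hc⟩ := hAP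
  set n := #(A + B) with hn
  -- `(A + T) + B = (A + B) + T` lies in a run of `|A + B| + 2` terms
  have hsub : A + T + B ⊆ apFinset (c + 0) d (n + 3 - 1) := by
    rw [add_right_comm, hc]
    exact apFinset_add_apFinset_subset c 0 d n 3
  have hcard : #(A + T + B) ≤ n + 2 :=
    (card_le_card hsub).trans ((card_apFinset_le _ _ _).trans (by omega))
  have hne : A + T + B ≠ univ := ne_univ_of_card_lt (by omega)
  have hTne : T.Nonempty := apFinset_nonempty 0 d (by norm_num)
  have hcd := Vosper.cauchy_davenport_of_ne_univ (hA.add hTne) hB hne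
  have h3 : #(A + T) ≤ #A + 3 := by omega
  have hATu : A + T ≠ univ := ne_univ_of_card_lt (by omega)
  rw [hT, ← add_pair_add_pair_eq] at h3 hATu
  exact subset_apFinset_of_card_add_pair_add_pair_le hd hA hATu h3

/-! ## Holes: almost progressions that are not progressions -/

/-- **An almost progression which is not a progression misses an INTERIOR point of its hull.**  If
`A ⊆ P = {α, α + d, …, α + n d}` with `|A| = n ≥ 2`, `n + 1 ≤ p`... and `A` is not a `d`-progression, then
`P = A ∪ {q}` for a point `q ∉ A` whose two neighbours `q ± d` lie in `A`.
[cite: HamidouneRodseth2000, §1 (p. 251: "a `d`-progression with one term removed")] -/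
theorem exists_interior_hole {A : Finset (ZMod p)} {α d : ZMod p} (hd : d ≠ 0) {n : ℕ} (hn : 2 ≤ n)
    (hnp : n + 1 ≤ p) (hAP : A ⊆ apFinset α d (n + 1)) (hcard : #A = n) (hnot : ¬ IsAP A d) :
    ∃ q : ZMod p, q ∉ A ∧ insert q A = apFinset α d (n + 1) ∧ q - d ∈ A ∧ q + d ∈ A := by
  set P := apFinset α d (n + 1) with hP
  have hcP : #P = n + 1 := card_apFinset hd hnp
  have hsd : #(P \ A) = 1 := by rw [card_sdiff_of_subset hAP]; omega
  obtain ⟨q, hq⟩ := card_eq_one.1 hsd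
  have hqmem : q ∈ P \ A := by rw [hq]; exact mem_singleton_self q
  rw [mem_sdiff] at hqmem
  obtain ⟨hqP, hqA⟩ := hqmem
  have hins : insert q A = P := by
    apply Subset.antisymm (insert_subset hqP hAP)
    intro x hx
    by_cases hxA : x ∈ A
    · exact mem_insert_of_mem hxA
    · have : x ∈ P \ A := mem_sdiff.2 ⟨hx, hxA⟩
      rw [hq, mem_singleton] at this
      rw [this]; exact mem_insert_self _ _
  have memA : ∀ x ∈ P, x ≠ q → x ∈ A := fun x hx hxq => by
    have : x ∈ insert q A := by rw [hins]; exact hx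
    exact (mem_insert.1 this).resolve_left hxq
  obtain ⟨i, hi, hiq⟩ := mem_apFinset.1 hqP
  refine ⟨q, hqA, hins, ?_, ?_⟩
  · -- `q − d ∈ A`: `i ≠ 0`, else `A = {α + d, …}` is a progression
    have hi0 : i ≠ 0 := by
      rintro rfl
      rw [zero_nsmul, add_zero] at hiq
      apply hnot
      have hsplit : P = apFinset α d 1 ∪ apFinset (α + (1 : ℕ) • d) d n := by
        rw [hP, show n + 1 = 1 + n by omega]; exact apFinset_add_eq_union α d 1 n
      rw [one_nsmul, apFinset_one] at hsplit
      have hAsub : A ⊆ apFinset (α + d) d n := by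
        intro x hx
        have hxP := hAP hx
        rw [hsplit, mem_union, mem_singleton] at hxP
        rcases hxP with rfl | h
        · exact absurd hx (hiq ▸ hqA)
        · exact h
      have hAeq : A = apFinset (α + d) d n :=
        eq_of_subset_of_card_le hAsub (by rw [hcard]; exact card_apFinset_le _ _ _)
      exact ⟨α + d, by rw [hcard]; exact hAeq⟩
    apply memA
    · rw [← hiq]
      refine mem_apFinset.2 ⟨i - 1, by omega, ?_⟩
      rw [eq_sub_iff_add_eq, add_assoc, ← succ_nsmul, show i - 1 + 1 = i by omega]
    · rw [← hiq]; intro h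
      have : α + i • d - d + d = α + i • d + d := by rw [h]
      rw [sub_add_cancel] at this
      exact hd (by simpa using this.symm)
  · -- `q + d ∈ A`: `i ≠ n`, else `A = {α, …, α + (n-1)d}` is a progression
    have hin : i ≠ n := by
      rintro rfl
      apply hnot
      have hsplit : P = apFinset α d i ∪ apFinset (α + i • d) d 1 := apFinset_add_eq_union α d i 1
      rw [apFinset_one] at hsplit
      have hAsub : A ⊆ apFinset α d i := by
        intro x hx
        have hxP := hAP hx
        rw [hsplit, mem_union, mem_singleton] at hxP
        rcases hxP with h | rfl
        · exact h
        · exact absurd hx (hiq ▸ hqA)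
      have hAeq : A = apFinset α d i :=
        eq_of_subset_of_card_le hAsub (by rw [hcard]; exact card_apFinset_le _ _ _)
      exact ⟨α, by rw [hcard]; exact hAeq⟩
    apply memA
    · rw [← hiq, add_assoc, ← succ_nsmul]
      exact mem_apFinset.2 ⟨i + 1, by omega, rfl⟩
    · rw [← hiq]; intro h
      exact hd (by simpa using h)

/-- Every point of a run of at least two terms has a neighbour in the run. [cite: Nathanson1996, §2.5 (arithmetic progressions in ℤ/pℤ)] -/
theorem neighbour_mem_apFinset {b d : ZMod p} {m : ℕ} (hm : 2 ≤ m) :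
    ∀ β ∈ apFinset b d m, β + d ∈ apFinset b d m ∨ β - d ∈ apFinset b d m := by
  intro β hβ
  obtain ⟨i, hi, rfl⟩ := mem_apFinset.1 hβ
  by_cases h : i + 1 < m
  · left; exact mem_apFinset.2 ⟨i + 1, h, by rw [succ_nsmul, add_assoc]⟩
  · right
    refine mem_apFinset.2 ⟨i - 1, by omega, ?_⟩
    rw [eq_sub_iff_add_eq, add_assoc, ← succ_nsmul, show i - 1 + 1 = i by omega]

/-- **Filling a hole.**  If `q − d, q + d ∈ A` and every point of `Q` has a neighbour (`± d`) in `Q`, then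
`(A ∪ {q}) + Q = A + Q`: `q + β = (q − d) + (β + d) = (q + d) + (β − d)`. [cite: HamidouneRodseth2000, §4 (p. 257: `A + B₂` is a 1-progression when `A` is an almost progression and `|B₂| ≥ 2`)] -/
theorem insert_add_eq_add_of_neighbours {A Q : Finset (ZMod p)} {q d : ZMod p} (hq1 : q - d ∈ A)
    (hq2 : q + d ∈ A) (hQ : ∀ β ∈ Q, β + d ∈ Q ∨ β - d ∈ Q) : insert q A + Q = A + Q := by
  apply Subset.antisymm _ (add_subset_add_right (subset_insert q A))
  intro x hx
  obtain ⟨y, hy, β, hβ, rfl⟩ := mem_add.1 hx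
  rcases mem_insert.1 hy with rfl | hyA
  · rcases hQ β hβ with h | h
    · exact mem_add.2 ⟨y - d, hq1, β + d, h, by abel⟩
    · exact mem_add.2 ⟨y + d, hq2, β - d, h, by abel⟩
  · exact mem_add.2 ⟨y, hyA, β, hβ, rfl⟩

/-- `{0, d}` has the neighbour property. [cite: Nathanson1996, §2.5 (arithmetic progressions in ℤ/pℤ)] -/
theorem neighbour_mem_pair_zero (d : ZMod p) :
    ∀ β ∈ ({0, d} : Finset (ZMod p)), β + d ∈ ({0, d} : Finset (ZMod p)) ∨ β - d ∈ ({0, d} : Finset (ZMod p)) := by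
  intro β hβ
  simp only [mem_insert, mem_singleton] at hβ ⊢
  rcases hβ with rfl | rfl
  · left; right; rw [zero_add]
  · right; left; rw [sub_self]

end HamidouneRodseth

end Literature.Combinatorics.Additive
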